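import Mathlib
import Summits.NavierStokesRegularity.NavierStokesRegularity.Theorems.ThreadingFluxHorizonTowerFiniteTowerDefs
import Summits.NavierStokesRegularity.NavierStokesRegularity.Theorems.ThreadingFluxHorizonTowerFiniteTowerTwoFourSixEight
import HarnessLib

/-!
# Crux `PoloidalLiouville` (stmt-NavierStokesRegularity-1222), crux idea «horizon-threading-tower» (ns-idea-15):
# `TwoFourSixEightHorizonTowerZonality` BY NAME (THM I, the tower `{2, 4, 6, 8}`)

Support file (`--supports stmt-NavierStokesRegularity-1222`, helper; cell `ns-wall-extremal`, width hand ns-wall-eng-3 g5; 0 kit).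
One-line application of `finiteTower_zonalForm_of_twoFourSixEight` (`…FiniteTowerTwoFourSixEight`).
HONEST LABEL: one cell of the crux-idea conjecture `HorizonTowerZonality` at ORDER ONE; general towers, `PoloidalLiouville` (1222) OPEN;
W1 movement 0; NS regularity NOT proved.
-/

-- the summit and its single sub-problem share the name (CONVENTIONS §1)
set_option linter.dupNamespace false

noncomputable section

namespace Summit.NavierStokesRegularity.NavierStokesRegularity.Theorems.PoloidalLiouville.HorizonTower

/-- ★★ `TwoFourSixEightHorizonTowerZonality` BY NAME (THM I). -/
theorem twoFourSixEightHorizonTowerZonality : TwoFourSixEightHorizonTowerZonality :=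
  fun H hH hhom hharm h6 h8 hL1 => finiteTower_zonalForm_of_twoFourSixEight H hH hhom hharm hL1 h6 h8

end Summit.NavierStokesRegularity.NavierStokesRegularity.Theorems.PoloidalLiouville.HorizonTower

end
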